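import Summits.QuantumFields.YangMills.Theorems.BalabanUVNodesK2NamedJetsRunRemAt
import Literature.MathematicalPhysics.QuantumFieldTheory.Balaban1983to89.T4BetaStationary
import Literature.MathematicalPhysics.QuantumFieldTheory.Balaban1983to89.Node00.Record13SepCoPHChi  -- v11 §7: `Stage13HParams.Provisos₁₃SepCoPHAx` (K1ᴬ V11 letter shape)

/-!
# LENS-2 (ideator 2 of 2, lens (ii) RG-flow ∕ stable-manifold regularity) — gen 8, sketch v10:
# ROW (C) `SurvCont` IS RUN-INTERNAL ON THE β SIDE — it is EQUIVALENT to continuity of each `β_k` on the REALISED RUN FAMILY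
# (the one-parameter set of in-window run prefixes), and is supplied by RUN-PAIR moduli; no history off the flow graph is ever read.

Cell `ym-nodeO-ideate`, unit `ymgap-nodeO-lens-2-g8` (planner, count-neutral: 0 proposals · 0 kit · 0 lit).  Companion of HOME
`nodeO-cover/LENS-2-NODE-v8.md`.  Pure [folklore] topology over the tree's carriers `FlowStep.HBeta ∕ Box ∕ Y ∕ gClamp ∕ clampPrefix ∕ BetaContH`,
`…K2NamedJetsRunRemAt.Survivors ∕ SurvCont` (K1ᴬ row (C)'s letter, route `BalabanUVNodes` decl `StabilityBRunRowsAtRecordR13SepCoPHVAx` last conjunct),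
`T4CouplingMatching.HistLipschitz` (node N22 ∕ NE9's β-side currency) — all BY NAME; nothing re-declared; no `sorry`; standard axioms.

THE POINT (answers lens-2 g7's leaf R «the regularity socket is BOX by nature» and its prediction P1 «the first foreign history of the cone is the SUPPLY of
K1ᴬ row (C)»).  Every supplier of `SurvCont` in the tree goes through a BOX-WIDE letter (`SurvCont.of_betaContH`, `survCont_allLevels_of_histLipschitz`,
`Gaps.EndSurvivorCensus.survCont_of_folCont ∘ folCont_of_betaContH`): continuity ∕ Lipschitz moduli of `β_k` at pairs of ARBITRARY box histories, almost all of them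
foreign to the flow.  HERE: (§2) `SurvCont β γ₀ ↔ RunFamilyCont β γ₀` — continuity of `β_k` RESTRICTED TO `RunFamily β γ₀ k := clampPrefix β γ₀ k '' Survivors β γ₀ k`
(the realised in-window run prefixes of length `k`, a curve in `Box γ₀ k` parametrised by the bare coupling; `→`: the first coordinate of a run prefix IS its bare
coupling, `Gaps.EndSurvivorExtension.clampPrefix_zero`; `←`: strong induction on the scale through `FlowStep.Y_succ'`, the step `continuousOn_Y` of [I] Thm 2's
shooting with the box replaced by the run family); (§3) RUN-PAIR moduli `RunPairModulus Λ β γ₀` (`HistLipschitz`'s inequality asked ONLY at pairs of realised run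
prefixes) ⟹ `RunFamilyCont` ⟹ `SurvCont`, and `HistLipschitz ⟹ RunPairModulus` (BOX ⟹ RUNS); (§4) STRICTNESS: the diagonal-blind family `betaDiag` has
`RunFamilyCont` ∕ `SurvCont` at every level and NEITHER `BetaContH` NOR `HistLipschitz` at any level `γ₀ > 0` — so the run-family road is a STRICTLY WEAKER
supplier shape than every box road of the tree, and row (C) needs TWO RUNS (two bare couplings), never a history off the flow graph.  (§5) the same at the record's
`Node00.betaOfRecord₁₃Ax F 2 θ` (K1ᴬ row (C)'s own β, BY NAME).  (§6) LOCATED: the regularity clause PRINTED in [I] (p.263 L25–26, p.264 L25–27) is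
smoothness in the LAST coupling only; its C⁰ shadow `LastCoordCont` is INCOMPARABLE with row (C) (toy witnesses `betaFirst`, `betaDiag`), so row (C)
is not covered by the printed assertion even as an assertion — the joint regularity along a run is the OLD-TERM channel (`StepLipschitz`'s `a k j`).
LENS (ii) READING.  `RunPairModulus` is C⁰-dependence of the RG trajectory's read-outs on the ONE real parameter of the stable manifold (the bare coupling);
its quantitative supplier is the Lipschitz edition of the ONE STEP along run pairs — `T4HistoryLipschitzRecursion.StepLipschitz E W κ lam a` with the
history window `W` := the realised runs (ROAD 1 of node N22, `ne9_of_stepLipschitz`, `W` is a free parameter there) — a W1 output like every other letter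
(HONEST: same wall as NODE O's step; print [I] p. 263 states the C^∞ clause box-wide, so the print cost is unchanged — lens-2 g7's width observation W).

HONEST FRAMING.  Elementary real analysis about hypothesis SHAPES; `SurvCont`, `RunFamilyCont`, `RunPairModulus`, `HistLipschitz`, `BetaContH` are inhabited here
ONLY by the toy family `betaDiag` (§4); NOTHING of Bałaban's is asserted, ported or discharged; K0ᴬ stmt-QuantumFields-27238 ∕ K0⁷ -20541 ∕ K1ᴬ -27239 OPEN and
untouched; NODE O 0∕1; node N22 ∕ (D4) NOT discharged; one finite 𝕋⁴ programme at fixed `ε = L^{−K}` (rung R4 closes the CONDITIONAL `BalabanLadder.UV` only);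
NOTHING about the continuum limit, ℝ⁴, OS axioms or the Clay problem; the Yang–Mills mass gap is NOT proved.
References (TYPES ∕ context only): [I] = T. Bałaban, Commun. Math. Phys. 109 (1987): Thm 2 p. 259, (0.20) p. 256, §1 pp. 263–264 (continuity in the coupling
asserted, box-wide), (1.18) p. 263; Thm 3 p. 264.
-/

noncomputable section

open Set Filter Topology
open scoped BigOperators

namespace Summit.QuantumFields.YangMills.Cruxes.Record13SepCoPHInhabited.Lens2G8

open Literature.MathematicalPhysics.QuantumFieldTheory.Balaban1983to89
open Literature.MathematicalPhysics.QuantumFieldTheory.Balaban1983to89.FlowStep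
open Literature.MathematicalPhysics.QuantumFieldTheory.Balaban1983to89.T4Continuum (T4Family)
open Literature.MathematicalPhysics.QuantumFieldTheory.Balaban1983to89.T4CouplingMatching (HistLipschitz)
open Summit.QuantumFields.YangMills.Theorems.BalabanUVNodesK2NamedJetsRunRemAt (Survivors SurvCont)
open Summit.QuantumFields.BalabanUV.Gaps.EndSurvivorExtension (clampPrefix_zero)

variable {β : HBeta} {γ₀ : ℝ}

/-! ## §1 The realised run family and its continuity letter -/

/-- THE REALISED RUN FAMILY of level `γ₀` at scale `k`: the `γ₀`-clamped forward prefixes `(ĝ(Y_0 x), …, ĝ(Y_k x))` of the SURVIVING bare couplings `x`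
(= the in-window run prefixes of length `k` of (0.20), `…K1WindowKOfRunRowsSurvivors.clampPrefix_eq_prefixOf_genSeq`); a one-parameter subset of `Box γ₀ k`. [folklore] -/
def RunFamily (β : HBeta) (γ₀ : ℝ) (k : ℕ) : Set (Fin (k + 1) → ℝ) :=
  clampPrefix β γ₀ k '' Survivors β γ₀ k

/-- HYPOTHESIS SHAPE (never a fact): **RUN-FAMILY CONTINUITY** — each `β_k` is continuous ON THE REALISED RUN FAMILY (subspace topology); no box point off the
flow graph is read. [folklore] -/
def RunFamilyCont (β : HBeta) (γ₀ : ℝ) : Prop :=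
  ∀ k : ℕ, ContinuousOn (β k) (RunFamily β γ₀ k)

/-- HYPOTHESIS SHAPE (never a fact): **RUN-PAIR MODULI** — `T4CouplingMatching.HistLipschitz`'s inequality `|β_k p − β_k q| ≤ Σ_i Λ k i·|p_i − q_i|` asked ONLY at
pairs `p, q` of realised run prefixes (two runs, two bare couplings). [folklore] -/
def RunPairModulus (Λ : ℕ → ℕ → ℝ) (β : HBeta) (γ₀ : ℝ) : Prop :=
  ∀ k : ℕ, ∀ p ∈ RunFamily β γ₀ k, ∀ q ∈ RunFamily β γ₀ k, |β k p - β k q| ≤ ∑ i : Fin (k + 1), Λ k i * |p i - q i|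

/-- The run family lies in the box. [folklore] -/
theorem runFamily_subset_box (hγ₀ : 0 < γ₀) (k : ℕ) : RunFamily β γ₀ k ⊆ Box γ₀ k := by
  rintro _ ⟨x, _, rfl⟩
  exact clampPrefix_mem_box hγ₀ k x

/-- Survivor sets decrease with the scale. [folklore] -/
theorem survivors_mono {j k : ℕ} (hjk : j ≤ k) : Survivors β γ₀ k ⊆ Survivors β γ₀ j :=
  fun _ hx => ⟨hx.1, hx.2.1, fun i hi => hx.2.2 i (hi.trans hjk)⟩

/-- BOX ⟹ RUN FAMILY: continuity on the boxes restricts to the run family. [folklore] -/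
theorem RunFamilyCont.of_betaContH (hγ₀ : 0 < γ₀) (h : BetaContH γ₀ β) : RunFamilyCont β γ₀ :=
  fun k => (h k).mono (runFamily_subset_box hγ₀ k)

/-- BOX ⟹ RUNS for the moduli: `HistLipschitz Λ γ₀ β` restricts to run pairs. [folklore] -/
theorem RunPairModulus.of_histLipschitz {Λ : ℕ → ℕ → ℝ} (hγ₀ : 0 < γ₀) (h : HistLipschitz Λ γ₀ β) : RunPairModulus Λ β γ₀ :=
  fun k p hp q hq => h k p q (runFamily_subset_box hγ₀ k hp) (runFamily_subset_box hγ₀ k hq)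

/-! ## §2 Row (C) ⟺ run-family continuity -/

/-- The clamped table `Y_i`, `i ≤ j ≤ k`, is continuous on the survivor set of scale `k` as soon as `β_0, …, β_{k−1}` are continuous on their run families
(strong induction on `j`; the step of `FlowStep.continuousOn_Y` with the box replaced by the run family). [folklore] -/
theorem continuousOn_Y_survivors (hγ₀ : 0 < γ₀) (hRF : RunFamilyCont β γ₀) (k : ℕ) :
    ∀ j, j ≤ k → ∀ i, i ≤ j → ContinuousOn (Y β γ₀ i) (Survivors β γ₀ k) := by
  intro j
  induction j with
  | zero =>
    intro _ i hi
    obtain rfl := Nat.le_zero.mp hi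
    have e : Y β γ₀ 0 = fun x => 1 / x ^ 2 := funext (Y_zero (β := β) (γ := γ₀))
    rw [e]
    exact continuousOn_const.div (continuous_pow 2).continuousOn fun x hx => pow_ne_zero 2 (ne_of_gt hx.1)
  | succ j ih =>
    intro hjk i hi
    have hj : j ≤ k := (Nat.le_succ j).trans hjk
    rcases hi.lt_or_eq with hlt | rfl
    · exact ih hj i (Nat.lt_succ_iff.mp hlt)
    · have e : Y β γ₀ (j + 1) = fun x => Y β γ₀ j x - β j (clampPrefix β γ₀ j x) :=
        funext (Y_succ' (β := β) (γ := γ₀) j)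
      rw [e]
      refine (ih hj j le_rfl).sub ?_
      have hpre : ContinuousOn (fun x => clampPrefix β γ₀ j x) (Survivors β γ₀ k) := by
        rw [continuousOn_pi]
        intro i
        exact (continuous_gClamp hγ₀).comp_continuousOn (ih hj i (Nat.lt_succ_iff.mp i.isLt))
      have hmaps : MapsTo (fun x => clampPrefix β γ₀ j x) (Survivors β γ₀ k) (RunFamily β γ₀ j) :=
        fun x hx => ⟨x, survivors_mono hj hx, rfl⟩
      exact (hRF j).comp hpre hmaps

/-- ★ **RUN FAMILY ⟹ ROW (C).**  Continuity of each `β_k` on the realised run family gives DEF-1's survivor continuity `SurvCont β γ₀` (K1ᴬ row (C)'s letter). [folklore] -/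
theorem survCont_of_runFamilyCont (hγ₀ : 0 < γ₀) (hRF : RunFamilyCont β γ₀) : SurvCont β γ₀ := by
  intro k
  have hY := continuousOn_Y_survivors hγ₀ hRF k k le_rfl
  have hpre : ContinuousOn (fun x => clampPrefix β γ₀ k x) (Survivors β γ₀ k) := by
    rw [continuousOn_pi]
    intro i
    exact (continuous_gClamp hγ₀).comp_continuousOn (hY i (Nat.lt_succ_iff.mp i.isLt))
  exact (hRF k).comp hpre fun x hx => ⟨x, hx, rfl⟩

/-- ★ **ROW (C) ⟹ RUN FAMILY.**  The bare coupling is the first coordinate of its run prefix (`clampPrefix_zero`), a continuous left inverse of the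
parametrisation; so the trace continuity transfers back to `β_k` on the run family (any `γ₀`). [folklore] -/
theorem runFamilyCont_of_survCont (hsc : SurvCont β γ₀) : RunFamilyCont β γ₀ := by
  intro k
  have hproj : ContinuousOn (fun p : Fin (k + 1) → ℝ => p 0) (RunFamily β γ₀ k) := (continuous_apply 0).continuousOn
  have hmaps : MapsTo (fun p : Fin (k + 1) → ℝ => p 0) (RunFamily β γ₀ k) (Survivors β γ₀ k) := by
    rintro _ ⟨x, hx, rfl⟩
    show clampPrefix β γ₀ k x 0 ∈ Survivors β γ₀ k
    rw [clampPrefix_zero k hx.1 hx.2.1]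
    exact hx
  refine ((hsc k).comp hproj hmaps).congr ?_
  rintro _ ⟨x, hx, rfl⟩
  show β k (clampPrefix β γ₀ k x) = β k (clampPrefix β γ₀ k (clampPrefix β γ₀ k x 0))
  rw [clampPrefix_zero k hx.1 hx.2.1]

/-- ★★ **ROW (C) IS RUN-INTERNAL ON THE β SIDE**: `SurvCont β γ₀ ↔ RunFamilyCont β γ₀` (`γ₀ > 0`). [folklore] -/
theorem survCont_iff_runFamilyCont (hγ₀ : 0 < γ₀) : SurvCont β γ₀ ↔ RunFamilyCont β γ₀ :=
  ⟨runFamilyCont_of_survCont, survCont_of_runFamilyCont hγ₀⟩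

/-! ## §3 Run-pair moduli supply row (C) -/

/-- Run-pair moduli make each `β_k` Lipschitz (sup metric, constant `Σ_i |Λ k i|`) on the run family, hence continuous there. [folklore] -/
theorem runFamilyCont_of_runPairModulus {Λ : ℕ → ℕ → ℝ} (h : RunPairModulus Λ β γ₀) : RunFamilyCont β γ₀ := by
  intro k
  rw [Metric.continuousOn_iff]
  intro b hb ε hε
  set M : ℝ := ∑ i : Fin (k + 1), |Λ k i| with hM
  have hM0 : 0 ≤ M := Finset.sum_nonneg fun i _ => abs_nonneg _
  refine ⟨ε / (M + 1), by positivity, fun a ha hab => ?_⟩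
  rw [Real.dist_eq]
  have hsum : |β k a - β k b| ≤ M * dist a b := by
    calc |β k a - β k b| ≤ ∑ i : Fin (k + 1), Λ k i * |a i - b i| := h k a ha b hb
      _ ≤ ∑ i : Fin (k + 1), |Λ k i| * dist a b := Finset.sum_le_sum fun i _ => by
          have h1 : Λ k i * |a i - b i| ≤ |Λ k i| * |a i - b i| :=
            mul_le_mul_of_nonneg_right (le_abs_self _) (abs_nonneg _)
          have h2 : |a i - b i| ≤ dist a b := by
            rw [← Real.dist_eq]
            exact dist_le_pi_dist a b i
          exact h1.trans (mul_le_mul_of_nonneg_left h2 (abs_nonneg _))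
      _ = M * dist a b := by rw [Finset.sum_mul]
  have hlt : M * dist a b < ε := by
    have hd : 0 ≤ dist a b := dist_nonneg
    calc M * dist a b ≤ (M + 1) * dist a b := by nlinarith
      _ < (M + 1) * (ε / (M + 1)) := mul_lt_mul_of_pos_left hab (by positivity)
      _ = ε := by field_simp
  exact hsum.trans_lt hlt

/-- ★ **RUN PAIRS ⟹ ROW (C).** [folklore] -/
theorem survCont_of_runPairModulus {Λ : ℕ → ℕ → ℝ} (hγ₀ : 0 < γ₀) (h : RunPairModulus Λ β γ₀) : SurvCont β γ₀ :=
  survCont_of_runFamilyCont hγ₀ (runFamilyCont_of_runPairModulus h)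

/-! ## §4 Strictness: the run-family road is strictly weaker than every box road -/

open Classical in
/-- THE DIAGONAL-BLIND FAMILY: `β_k ≡ 0` on the diagonal `{v_0 = … = v_k}`, `≡ 1` off it.  (A toy `HBeta`; nothing of Bałaban's.) [folklore] -/
def betaDiag : HBeta := fun k v => if ∀ i j : Fin (k + 1), v i = v j then 0 else 1

/-- On a constant vector `betaDiag` vanishes. [folklore] -/
theorem betaDiag_const (k : ℕ) (c : ℝ) : betaDiag k (fun _ => c) = 0 := by
  simp [betaDiag]

/-- Along `betaDiag`'s own clamped foliation nothing ever moves: `Y_i x = 1∕x²` for every `i`. [folklore] -/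
theorem Y_betaDiag (γ₀ x : ℝ) : ∀ j i, i ≤ j → Y betaDiag γ₀ i x = 1 / x ^ 2 := by
  intro j
  induction j with
  | zero =>
    intro i hi
    obtain rfl := Nat.le_zero.mp hi
    exact Y_zero (β := betaDiag) (γ := γ₀) x
  | succ j ih =>
    intro i hi
    rcases hi.lt_or_eq with hlt | rfl
    · exact ih i (Nat.lt_succ_iff.mp hlt)
    · rw [Y_succ' (β := betaDiag) (γ := γ₀) j x, ih j le_rfl]
      have hc : clampPrefix betaDiag γ₀ j x = fun _ => gClamp γ₀ (1 / x ^ 2) := by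
        funext i
        show gClamp γ₀ (Y betaDiag γ₀ (i : ℕ) x) = _
        rw [ih i (Nat.lt_succ_iff.mp i.isLt)]
      rw [hc, betaDiag_const, sub_zero]

/-- Hence every realised run prefix of `betaDiag` is a constant vector. [folklore] -/
theorem clampPrefix_betaDiag (γ₀ : ℝ) (k : ℕ) (x : ℝ) : clampPrefix betaDiag γ₀ k x = fun _ => gClamp γ₀ (1 / x ^ 2) := by
  funext i
  show gClamp γ₀ (Y betaDiag γ₀ (i : ℕ) x) = _
  rw [Y_betaDiag γ₀ x k i (Nat.lt_succ_iff.mp i.isLt)]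

/-- `betaDiag` is continuous on every run family (it is `≡ 0` there) … [folklore] -/
theorem runFamilyCont_betaDiag (γ₀ : ℝ) : RunFamilyCont betaDiag γ₀ := by
  intro k
  refine (continuousOn_const (c := (0 : ℝ))).congr ?_
  rintro _ ⟨x, _, rfl⟩
  show betaDiag k (clampPrefix betaDiag γ₀ k x) = (0 : ℝ)
  rw [clampPrefix_betaDiag, betaDiag_const]

/-- … hence has row (C) at every level `γ₀ > 0` — through the run-family road, the box roads being closed to it (next two theorems). [folklore] -/
theorem survCont_betaDiag {γ₀ : ℝ} (hγ₀ : 0 < γ₀) : SurvCont betaDiag γ₀ :=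
  survCont_of_runFamilyCont hγ₀ (runFamilyCont_betaDiag γ₀)

/-- … but is NOT continuous on the box `Box γ₀ 1` (jump across the diagonal at `(γ₀∕2, γ₀∕2)`). [folklore] -/
theorem not_betaContH_betaDiag {γ₀ : ℝ} (hγ₀ : 0 < γ₀) : ¬ BetaContH γ₀ betaDiag := by
  intro h
  set a : Fin 2 → ℝ := fun _ => γ₀ / 2 with ha
  have hab : a ∈ Box γ₀ 1 := mem_box.mpr fun _ => show 0 < γ₀ / 2 ∧ γ₀ / 2 ≤ γ₀ from ⟨by positivity, by linarith⟩
  obtain ⟨δ, hδ, hδε⟩ := (Metric.continuousWithinAt_iff.mp (h 1 a hab)) (1 / 2) one_half_pos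
  set t : ℝ := min (δ / 2) (γ₀ / 2) with ht
  have ht0 : 0 < t := lt_min (by positivity) (by positivity)
  have htδ : t < δ := (min_le_left _ _).trans_lt (by linarith)
  have htγ : t ≤ γ₀ / 2 := min_le_right _ _
  set x : Fin 2 → ℝ := fun i => if i = 0 then γ₀ / 2 else γ₀ / 2 + t with hx
  have hx0 : x 0 = γ₀ / 2 := by simp [hx]
  have hx1 : x 1 = γ₀ / 2 + t := by simp [hx]
  have hxb : x ∈ Box γ₀ 1 := by
    refine mem_box.mpr (Fin.forall_fin_two.mpr ⟨?_, ?_⟩)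
    · rw [hx0]; exact ⟨by positivity, by linarith⟩
    · rw [hx1]; exact ⟨by positivity, by linarith⟩
  have hdist : dist x a < δ := by
    refine (dist_pi_lt_iff hδ).mpr (Fin.forall_fin_two.mpr ⟨?_, ?_⟩)
    · rw [hx0, show a 0 = γ₀ / 2 from rfl, dist_self]; exact hδ
    · rw [hx1, show a 1 = γ₀ / 2 from rfl, Real.dist_eq, show γ₀ / 2 + t - γ₀ / 2 = t by ring, abs_of_pos ht0]
      exact htδ
  have hfa : betaDiag 1 a = 0 := betaDiag_const 1 (γ₀ / 2)
  have hfx : betaDiag 1 x = 1 := by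
    have hne : ¬ ∀ i j : Fin (1 + 1), x i = x j := by
      intro hall
      have := hall 0 1
      rw [hx0, hx1] at this
      linarith
    simp only [betaDiag]
    rw [if_neg hne]
  have := hδε hxb hdist
  rw [hfx, hfa, Real.dist_eq, sub_zero, abs_one] at this
  linarith

/-- … and carries NO box-wide history moduli at any level `γ₀ > 0` (`T4BetaStationary.betaContH_of_histLipschitz`, contraposed). [folklore] -/
theorem not_histLipschitz_betaDiag {γ₀ : ℝ} (hγ₀ : 0 < γ₀) (Λ : ℕ → ℕ → ℝ) : ¬ HistLipschitz Λ γ₀ betaDiag :=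
  fun hL => not_betaContH_betaDiag hγ₀ (T4BetaStationary.betaContH_of_histLipschitz hL)

/-- ★★ **STRICTNESS OF THE RUN-FAMILY ROAD**: a family with row (C) (indeed run-family continuity and run-pair moduli `Λ ≡ 0`) at every level and NO box
letter (`BetaContH`, `HistLipschitz`) at any level — the tree's box suppliers `SurvCont.of_betaContH` ∕ `survCont_allLevels_of_histLipschitz` cannot fire on it. [folklore] -/
theorem runFamilyRoad_strict {γ₀ : ℝ} (hγ₀ : 0 < γ₀) :
    RunFamilyCont betaDiag γ₀ ∧ RunPairModulus (fun _ _ => 0) betaDiag γ₀ ∧ SurvCont betaDiag γ₀ ∧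
      ¬ BetaContH γ₀ betaDiag ∧ ∀ Λ : ℕ → ℕ → ℝ, ¬ HistLipschitz Λ γ₀ betaDiag := by
  refine ⟨runFamilyCont_betaDiag γ₀, ?_, survCont_betaDiag hγ₀, not_betaContH_betaDiag hγ₀, not_histLipschitz_betaDiag hγ₀⟩
  rintro k _ ⟨x, _, rfl⟩ _ ⟨x', _, rfl⟩
  rw [clampPrefix_betaDiag, clampPrefix_betaDiag, betaDiag_const, betaDiag_const, sub_self, abs_zero]
  exact Finset.sum_nonneg fun i _ => by rw [zero_mul]

/-! ## §5 At the record: K1ᴬ row (C)'s own β -/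

/-- ★ **K1ᴬ ROW (C) AT THE RECORD IS RUN-INTERNAL**: for the record's `β₁₃Ax` (decl `StabilityBRunRowsAtRecordR13SepCoPHVAx`, last conjunct, BY NAME),
`SurvCont (betaOfRecord₁₃Ax F 2 θ) γ₀ ↔ RunFamilyCont (betaOfRecord₁₃Ax F 2 θ) γ₀`; and run-pair moduli supply it.  Nothing of Bałaban's inhabited. [folklore] -/
theorem survCont_betaOfRecord₁₃Ax_iff_runFamilyCont (F : T4Family) (θ : Node00.Stage13Params F 2) {γ₀ : ℝ} (hγ₀ : 0 < γ₀) :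
    SurvCont (Node00.betaOfRecord₁₃Ax F 2 θ) γ₀ ↔ RunFamilyCont (Node00.betaOfRecord₁₃Ax F 2 θ) γ₀ :=
  survCont_iff_runFamilyCont hγ₀

/-- Run-pair moduli of the record's `β₁₃Ax` at level `γ₀` give K1ᴬ row (C) at `γ₀`. [folklore] -/
theorem survCont_betaOfRecord₁₃Ax_of_runPairModulus (F : T4Family) (θ : Node00.Stage13Params F 2) {γ₀ : ℝ} (hγ₀ : 0 < γ₀)
    {Λ : ℕ → ℕ → ℝ} (h : RunPairModulus Λ (Node00.betaOfRecord₁₃Ax F 2 θ) γ₀) :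
    SurvCont (Node00.betaOfRecord₁₃Ax F 2 θ) γ₀ :=
  survCont_of_runPairModulus hγ₀ h

/-! ## §6 Print's clause is LAST-COUPLING regularity — incomparable with the run-family letter

LOCATED ([I] = Bałaban, CMP 109 (1987), held `paper:balaban1987-cmp109-rg-i-small-field`): p.263 L25–26 «It [E^{(j)}(X, g_{j−1}, U, J)] is a C^∞-function of
g_{j−1} ∈ [0, γ], (or analytic)»; p.264 L25–27 «[β_{j+1}(g_j)] is a smooth function defined on the interval [0, γ], (or analytic), uniformly bounded on this
interval together with all derivatives. We will investigate other properties in a separate paper.»; p.259 L44–45 «A proof of this theorem [Thm 2, the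
shooting], based on perturbative calculations, will be given in a separate paper».  So the printed regularity clause is smoothness in the LAST coupling
of each created term ∕ of each β, the earlier couplings entering only through the (fixed) action A_j.  Its C⁰ shadow on the tree's carrier is
`LastCoordCont` below.  KERNEL: `LastCoordCont` and `RunFamilyCont` (⟺ row (C)) are INCOMPARABLE — `betaFirst` is CONSTANT in the last coupling
(so it satisfies the printed clause in its strongest reading, all last-variable derivatives zero) and has NO row (C); `betaDiag` has row (C) and is
not last-coupling continuous; `BetaContH` implies both.  READING (honest): row (C) at the record is not covered by [I]'s printed ASSERTION even as an
assertion; the joint regularity along a run needs the dependence of the step on the OLD TERMS — `T4HistoryLipschitzRecursion.StepLipschitz`'s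
constants `a k j` (p.270 «sum of localized irrelevant terms», no constant printed) on top of `lam k` (p.263's clause, no constant printed). -/

/-- HYPOTHESIS SHAPE (never a fact): **LAST-COUPLING CONTINUITY** — the C⁰ shadow of [I] p.263 L25–26 ∕ p.264 L25–27: at every box history, `β_k` is
continuous in its LAST coupling on `]0, γ₀]`, the earlier ones held fixed. [cite: Balaban1987RG1, §1 p.263 L25-26, p.264 L25-27 (shape only)] -/
def LastCoordCont (β : HBeta) (γ₀ : ℝ) : Prop :=
  ∀ k : ℕ, ∀ v ∈ Box γ₀ k, ContinuousOn (fun t : ℝ => β k (Function.update v (Fin.last k) t)) (Set.Ioc 0 γ₀)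

/-- BOX ⟹ LAST COUPLING. [folklore] -/
theorem LastCoordCont.of_betaContH (h : BetaContH γ₀ β) : LastCoordCont β γ₀ := by
  intro k v hv
  have hcont : Continuous (fun t : ℝ => Function.update v (Fin.last k) t) := continuous_const.update (Fin.last k) continuous_id
  refine (h k).comp hcont.continuousOn fun t ht => ?_
  refine mem_box.mpr fun i => ?_
  by_cases hi : i = Fin.last k
  · subst hi
    rw [Function.update_self]
    exact ⟨ht.1, ht.2⟩
  · rw [Function.update_of_ne hi]
    exact (mem_box.mp hv) i

open Classical in
/-- THE FIRST-COUPLING JUMP FAMILY: `β_0 ≡ 0`; for `k ≥ 1`, `β_k(v) = 1` if `γ₀∕2 < v_0` and `0` otherwise — constant in the last coupling, a jump in the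
bare one.  (A toy `HBeta`; nothing of Bałaban's.) [folklore] -/
def betaFirst (γ₀ : ℝ) : HBeta := fun k v => if k = 0 then 0 else if γ₀ / 2 < v 0 then 1 else 0

/-- `betaFirst` is last-coupling continuous (indeed constant in the last coupling) at every box history. [folklore] -/
theorem lastCoordCont_betaFirst (γ₀ : ℝ) : LastCoordCont (betaFirst γ₀) γ₀ := by
  intro k v _
  cases k with
  | zero =>
    refine (continuousOn_const (c := (0 : ℝ))).congr fun t _ => ?_
    simp [betaFirst]
  | succ k =>
    have h0 : (0 : Fin (k + 2)) ≠ Fin.last (k + 1) := by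
      intro h
      have := congrArg Fin.val h
      simp at this
    refine (continuousOn_const (c := if γ₀ / 2 < v 0 then (1 : ℝ) else 0)).congr fun t _ => ?_
    show betaFirst γ₀ (k + 1) (Function.update v (Fin.last (k + 1)) t) = _
    simp only [betaFirst, Nat.succ_ne_zero, if_false]
    rw [Function.update_of_ne h0]

/-- Up to scale `1` nothing moves along `betaFirst`'s foliation (`β_0 ≡ 0`). [folklore] -/
theorem Y_betaFirst_le_one (γ₀ x : ℝ) : ∀ j, j ≤ 1 → Y (betaFirst γ₀) γ₀ j x = 1 / x ^ 2 := by
  intro j hj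
  interval_cases j
  · exact Y_zero (β := betaFirst γ₀) (γ := γ₀) x
  · rw [Y_succ' (β := betaFirst γ₀) (γ := γ₀) 0 x, Y_zero (β := betaFirst γ₀) (γ := γ₀) x]
    simp [betaFirst]

/-- Every bare coupling of `]0, γ₀]` survives scale `1` under `betaFirst`. [folklore] -/
theorem mem_survivors_betaFirst_one {γ₀ x : ℝ} (hx : 0 < x) (hxγ : x ≤ γ₀) : x ∈ Survivors (betaFirst γ₀) γ₀ 1 := by
  refine ⟨hx, hxγ, fun j hj => ?_⟩
  rw [Y_betaFirst_le_one γ₀ x j hj]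
  exact one_div_le_one_div_of_le (by positivity) (pow_le_pow_left₀ hx.le hxγ 2)

/-- ★ `betaFirst` has NO row (C): its scale-`1` trace is the jump `x ↦ [γ₀∕2 < x]` on the survivor set `]0, γ₀]`. [folklore] -/
theorem not_survCont_betaFirst {γ₀ : ℝ} (hγ₀ : 0 < γ₀) : ¬ SurvCont (betaFirst γ₀) γ₀ := by
  intro h
  have hx0 : (γ₀ / 2) ∈ Survivors (betaFirst γ₀) γ₀ 1 := mem_survivors_betaFirst_one (by positivity) (by linarith)
  obtain ⟨δ, hδ, hδε⟩ := (Metric.continuousWithinAt_iff.mp (h 1 (γ₀ / 2) hx0)) (1 / 2) one_half_pos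
  set t : ℝ := min (δ / 2) (γ₀ / 2) with ht
  have ht0 : 0 < t := lt_min (by positivity) (by positivity)
  have htδ : t < δ := (min_le_left _ _).trans_lt (by linarith)
  have htγ : t ≤ γ₀ / 2 := min_le_right _ _
  have hx : (γ₀ / 2 + t) ∈ Survivors (betaFirst γ₀) γ₀ 1 := mem_survivors_betaFirst_one (by positivity) (by linarith)
  have hdist : dist (γ₀ / 2 + t) (γ₀ / 2) < δ := by
    rw [Real.dist_eq, show γ₀ / 2 + t - γ₀ / 2 = t by ring, abs_of_pos ht0]; exact htδ
  have key := hδε hx hdist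
  have e1 : betaFirst γ₀ 1 (clampPrefix (betaFirst γ₀) γ₀ 1 (γ₀ / 2 + t)) = 1 := by
    have h0 : clampPrefix (betaFirst γ₀) γ₀ 1 (γ₀ / 2 + t) 0 = γ₀ / 2 + t := clampPrefix_zero 1 hx.1 hx.2.1
    simp only [betaFirst, Nat.one_ne_zero, if_false]
    rw [h0, if_pos (by linarith)]
  have e0 : betaFirst γ₀ 1 (clampPrefix (betaFirst γ₀) γ₀ 1 (γ₀ / 2)) = 0 := by
    have h0 : clampPrefix (betaFirst γ₀) γ₀ 1 (γ₀ / 2) 0 = γ₀ / 2 := clampPrefix_zero 1 hx0.1 hx0.2.1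
    simp only [betaFirst, Nat.one_ne_zero, if_false]
    rw [h0, if_neg (lt_irrefl _)]
  rw [e1, e0, Real.dist_eq, sub_zero, abs_one] at key
  linarith

/-- … hence no run-family continuity either (`survCont_of_runFamilyCont`). [folklore] -/
theorem not_runFamilyCont_betaFirst {γ₀ : ℝ} (hγ₀ : 0 < γ₀) : ¬ RunFamilyCont (betaFirst γ₀) γ₀ :=
  fun h => not_survCont_betaFirst hγ₀ (survCont_of_runFamilyCont hγ₀ h)

/-- ★ `betaDiag` (row (C) at every level, §4) is NOT last-coupling continuous: at the box history `(γ₀∕2, γ₀∕2)` the last-coupling section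
`t ↦ β_1(γ₀∕2, t)` is `0` at `t = γ₀∕2` and `1` elsewhere. [folklore] -/
theorem not_lastCoordCont_betaDiag {γ₀ : ℝ} (hγ₀ : 0 < γ₀) : ¬ LastCoordCont betaDiag γ₀ := by
  intro h
  set a : Fin 2 → ℝ := fun _ => γ₀ / 2 with ha
  have hab : a ∈ Box γ₀ 1 := mem_box.mpr fun _ => show 0 < γ₀ / 2 ∧ γ₀ / 2 ≤ γ₀ from ⟨by positivity, by linarith⟩
  have hx0 : (γ₀ / 2) ∈ Set.Ioc (0 : ℝ) γ₀ := ⟨by positivity, by linarith⟩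
  obtain ⟨δ, hδ, hδε⟩ := (Metric.continuousWithinAt_iff.mp (h 1 a hab (γ₀ / 2) hx0)) (1 / 2) one_half_pos
  set t : ℝ := min (δ / 2) (γ₀ / 2) with ht
  have ht0 : 0 < t := lt_min (by positivity) (by positivity)
  have htδ : t < δ := (min_le_left _ _).trans_lt (by linarith)
  have htγ : t ≤ γ₀ / 2 := min_le_right _ _
  have hx : (γ₀ / 2 + t) ∈ Set.Ioc (0 : ℝ) γ₀ := ⟨by positivity, by linarith⟩
  have hdist : dist (γ₀ / 2 + t) (γ₀ / 2) < δ := by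
    rw [Real.dist_eq, show γ₀ / 2 + t - γ₀ / 2 = t by ring, abs_of_pos ht0]; exact htδ
  have key := hδε hx hdist
  have h10 : (0 : Fin 2) ≠ Fin.last 1 := by decide
  have e1 : betaDiag 1 (Function.update a (Fin.last 1) (γ₀ / 2 + t)) = 1 := by
    have hne : ¬ ∀ i j : Fin (1 + 1), Function.update a (Fin.last 1) (γ₀ / 2 + t) i = Function.update a (Fin.last 1) (γ₀ / 2 + t) j := by
      intro hall
      have := hall 0 (Fin.last 1)
      rw [Function.update_self, Function.update_of_ne h10] at this
      change γ₀ / 2 = γ₀ / 2 + t at this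
      linarith
    simp only [betaDiag]
    rw [if_neg hne]
  have e0 : betaDiag 1 (Function.update a (Fin.last 1) (γ₀ / 2)) = 0 := by
    have hupd : Function.update a (Fin.last 1) (γ₀ / 2) = a := by
      rw [Function.update_eq_self_iff]
    rw [hupd]
    exact betaDiag_const 1 (γ₀ / 2)
  rw [e1, e0, Real.dist_eq, sub_zero, abs_one] at key
  linarith

/-- ★★ **THE PRINTED CLAUSE AND ROW (C) ARE INCOMPARABLE** (both toy families at every `γ₀ > 0`): last-coupling regularity without row (C) (`betaFirst`),
row (C) without last-coupling continuity (`betaDiag`); the box letter `BetaContH` implies both (`LastCoordCont.of_betaContH`, `SurvCont.of_betaContH`). [folklore] -/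
theorem printClause_rowC_incomparable {γ₀ : ℝ} (hγ₀ : 0 < γ₀) :
    (LastCoordCont (betaFirst γ₀) γ₀ ∧ ¬ RunFamilyCont (betaFirst γ₀) γ₀ ∧ ¬ SurvCont (betaFirst γ₀) γ₀) ∧
      (RunFamilyCont betaDiag γ₀ ∧ SurvCont betaDiag γ₀ ∧ ¬ LastCoordCont betaDiag γ₀) :=
  ⟨⟨lastCoordCont_betaFirst γ₀, not_runFamilyCont_betaFirst hγ₀, not_survCont_betaFirst hγ₀⟩,
    ⟨runFamilyCont_betaDiag γ₀, survCont_betaDiag hγ₀, not_lastCoordCont_betaDiag hγ₀⟩⟩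

/-! ## §7 (v11, 2026-08-31T05:4xZ) ADAPTERS FOR K1ᴬ's REGISTERED STUB 3 `stub_cont13` (skeleton V11 54f620c18feea0f3, director-ym №514)

K1ᴬ V11's stub 3 `stub_cont13 : ∀ F, RunRowsAtSomeRecord13PWS F → RunRowsContAtSomeRecord13PWS F` adds ONE conjunct to the rows witness:
`SurvCont (Node00.betaOfRecord₁₃Ax F 2 θ.toStage13Params) γ₀` (level `0 < γ₀`, shrinkable); its ∀θ SUPPLIER letter is V11's `Cont13All` (`stubCont13_of_cont13All`, kernel, in the
skeleton).  `Cont13All` is restated VERBATIM here (the skeleton lives in the plan folder, not the tree) with: `cont13All_iff_cont13AllRF` (the letter is RUN-INTERNAL),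
`cont13All_of_rp13All` (a run-pair Λ-modulus at every admissible tuple supplies it), `cont13All_of_histLipschitz13All` (the box road of record factors through `RP13All`).
Adapters only; `Cont13All` ∕ `RP13All` ∕ stub 3 NOT proved here. -/

/-- K1ᴬ V11's ∀θ (C) SUPPLIER LETTER, verbatim (skeleton `K1Skeleton13SepCoPHAxV11.lean` :319–321). [cite: Balaban1987RG1, §1 pp.263–264 (statement shape only)] -/
def Cont13All : Prop :=
  ∀ (F : T4Family) (θ : Node00.Stage13HParams F 2), θ.Provisos₁₃SepCoPHAx F 2 → θ.Admissible F 2 →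
    ∀ γ₀ : ℝ, 0 < γ₀ → γ₀ ≤ θ.γ → SurvCont (Node00.betaOfRecord₁₃Ax F 2 θ.toStage13Params) γ₀

/-- RUN-FAMILY EDITION of `Cont13All`: continuity of each `β_k` of record on the realised run prefixes only. [this file] -/
def Cont13AllRF : Prop :=
  ∀ (F : T4Family) (θ : Node00.Stage13HParams F 2), θ.Provisos₁₃SepCoPHAx F 2 → θ.Admissible F 2 →
    ∀ γ₀ : ℝ, 0 < γ₀ → γ₀ ≤ θ.γ → RunFamilyCont (Node00.betaOfRecord₁₃Ax F 2 θ.toStage13Params) γ₀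

/-- RUN-PAIR MODULUS EDITION: at every admissible tuple and level, SOME coefficient table `Λ` bounds `|β_k p − β_k q|` for run prefixes `p, q`. [this file] -/
def RP13All : Prop :=
  ∀ (F : T4Family) (θ : Node00.Stage13HParams F 2), θ.Provisos₁₃SepCoPHAx F 2 → θ.Admissible F 2 →
    ∀ γ₀ : ℝ, 0 < γ₀ → γ₀ ≤ θ.γ → ∃ Λ : ℕ → ℕ → ℝ, RunPairModulus Λ (Node00.betaOfRecord₁₃Ax F 2 θ.toStage13Params) γ₀

/-- BOX ROAD OF RECORD as a ∀θ letter: history-Lipschitz moduli of the record's β on the whole box (what `…N22KernelsBetaHistLipschitz` ∕ `…N17HistModuliContRecord13` supply from kernel NE9 on `Window θ.γ`). [this file] -/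
def HistLipschitz13All : Prop :=
  ∀ (F : T4Family) (θ : Node00.Stage13HParams F 2), θ.Provisos₁₃SepCoPHAx F 2 → θ.Admissible F 2 →
    ∀ γ₀ : ℝ, 0 < γ₀ → γ₀ ≤ θ.γ → ∃ Λ : ℕ → ℕ → ℝ, HistLipschitz Λ γ₀ (Node00.betaOfRecord₁₃Ax F 2 θ.toStage13Params)

/-- ★ THE SUPPLIER LETTER OF STUB 3 IS RUN-INTERNAL: `Cont13All ↔ Cont13AllRF`. -/
theorem cont13All_iff_cont13AllRF : Cont13All ↔ Cont13AllRF := by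
  unfold Cont13All Cont13AllRF
  refine forall_congr' fun F => forall_congr' fun θ => forall_congr' fun _ => forall_congr' fun _ =>
    forall_congr' fun γ₀ => forall_congr' fun hγ₀ => forall_congr' fun _ => ?_
  exact survCont_betaOfRecord₁₃Ax_iff_runFamilyCont F θ.toStage13Params hγ₀

/-- ★ A RUN-PAIR MODULUS AT EVERY ADMISSIBLE TUPLE SUPPLIES THE LETTER: `RP13All → Cont13All`. -/
theorem cont13All_of_rp13All (h : RP13All) : Cont13All := by
  intro F θ hP hA γ₀ hγ₀ hle
  obtain ⟨Λ, hΛ⟩ := h F θ hP hA γ₀ hγ₀ hle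
  exact survCont_betaOfRecord₁₃Ax_of_runPairModulus F θ.toStage13Params hγ₀ hΛ

/-- The box road factors through the run-pair road: `HistLipschitz13All → RP13All`. -/
theorem rp13All_of_histLipschitz13All (h : HistLipschitz13All) : RP13All := by
  intro F θ hP hA γ₀ hγ₀ hle
  obtain ⟨Λ, hΛ⟩ := h F θ hP hA γ₀ hγ₀ hle
  exact ⟨Λ, RunPairModulus.of_histLipschitz hγ₀ hΛ⟩

/-- Hence the box road supplies the letter (= the road of record, re-read through the run family): `HistLipschitz13All → Cont13All`. -/
theorem cont13All_of_histLipschitz13All (h : HistLipschitz13All) : Cont13All :=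
  cont13All_of_rp13All (rp13All_of_histLipschitz13All h)

end Summit.QuantumFields.YangMills.Cruxes.Record13SepCoPHInhabited.Lens2G8

end
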